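import Literature.Computability.Cryptography.RegevSamplerInnerFamily
import Literature.Computability.Cryptography.RegevSamplerStdWord
import HarnessLib

/-!
# Regev 2009, Lemma 3.14 in machine form: the inner family IS the sampler — its kernel on the prepared word

Topic `Computability/Cryptography` (family `pqc`), grouping namespace `Regev2009.SamplerRegs`; sequel of
`RegevSamplerInnerFamily.lean` (`innerFamily Rf`: per input length `N`, the data-free machine circuit of the size
record decoded from `N` under the guard, no ancillas; oracle-free and polynomial-time uniform),
`RegevSamplerStdWord.lean` (`stdWord`: the prepared register label as an explicit word) and
`RegevSamplerBlockPar.lean` (`tvDist_machineCircPar_le_canonical`: the per-block bound of Lemma 3.14 for the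
canonical data-free circuit run on the prepared label).

The classical wrap (`CWrap.family`) runs the inner family on the word `u := h w` written by the pre-processor and
hands the measured register to the post-processor as a LIST of bits; its law-level kernel identity
(`CWrap.map_kernel_eq_of_read`) is stated for `F.kernel 0 (h w)`. This file identifies that kernel with the machine
analysed in `RegevSamplerBlockPar.lean`:

* `kernel_innerFamily` — the kernel of the inner family on a word `u`, as the Born law of its circuit at `|u|` run
  on `|u⟩` (no ancillas: `padInput x 0 = x`), mapped by `List.ofFn`;
* `kernel_innerFamily_of_guard` — on a word of a guarded length code `lenCode s wpad` the circuit is the guarded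
  machine circuit of the record `s` itself (`szOf_lenCode`, transport of the guard);
* `listReadS` — the residue register read off the output LIST (`n` blocks of `ℓ_R` bits at offset `o_S`), and
  `listReadS_ofFn : listReadS … (List.ofFn z) = readS (Sblk B Λ) z` for layouts placed in order;
* **`tvDist_innerFamily_kernel_le`** — **Regev 2009, Lemma 3.14, per block, for the inner family**: for the size
  record `s = (n, e, T, m, L, Lq, np, p₀)` of an instance `B` and a padding amount `wpad` whose length code
  `N = ⟪code s, wpad⟫` passes the guard, the law of the residue vector read off the output of `innerFamily Rf` on the
  standard word `stdWord B Λ_S uz ⟨init⟩` (input zone `uz = zoneOf Fq Pa (padWord g c pad')` carrying the query prefix,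
  the scale data and the Grover–Rudolph parameter word `c`; block content `init` = the parameter word in place) and
  decoded by `decZ`, is within `8·√(weightedFail Rf B r k y (aq/(√2ρ)) w) + νlevel(n)` of `intCoords_* D_{L(B), ρ√n/aq}`
  — literally `tvDist_machineCircPar_le_canonical` with `W := N`, `U := 6(p+ℓ+3)`, `S₀ := 0`, transported along
  `kernel_innerFamily_of_guard`, `boxLab_stdEmb_eq_getD` and `listReadS_ofFn`.

So the uniform, oracle-free family `innerFamily Rf` of `RegevSamplerInnerFamily.lean` is the quantum sampler of
Lemma 3.14 on prepared inputs: what remains to A_q14 (`regev2009_lemma_3_14_stepFamily`) is classical — the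
pre-processor writing `stdWord …` and the post-processor writing `⟨vecCode (decZ …)⟩` in `FP`, and the assembly through
`CWrap.exists_params` / `CWrap.map_kernel_eq_of_read` with the parameter schedule.

Everything is proved; no named fact is introduced; the constant is `C = 8` and the slack `νlevel`.
HONEST FRAMING: kernel-checked lemmas of a KNOWN reduction (Regev 2009) — not summit progress; A_q14 is not proved here.

## References

* O. Regev, *On lattices, learning with errors, random linear codes, and cryptography*, J. ACM 56 (2009), art. 34:
  Lemma 3.14 (statement and proof: the registers, "measure … obtain t", the last step) [Regev2009].
* M. A. Nielsen, I. L. Chuang, *Quantum Computation and Quantum Information*, CUP 2010, §2.2.5 (Born rule), §4.5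
  (circuit families on `|x⟩|0…0⟩`) [NielsenChuang2010].
* E. Bernstein, U. Vazirani, *Quantum complexity theory*, SIAM J. Comput. 26 (1997), §8 (classical computation
  inside quantum machines) [BernsteinVazirani1997].
-/

noncomputable section

namespace Literature.Computability.Cryptography

namespace Regev2009

namespace SamplerRegs

open Literature.Algebra.EuclideanLattices Literature.Algebra.EuclideanLattices.Regev2009
  Literature.Algebra.EuclideanLattices.Regev2009.QPart Literature.Computability.QuantumComplexity
  Literature.Computability.QuantumComplexity.GaussianCells Literature.Computability.QuantumComplexity.GroverRudolph
  Literature.Computability.QuantumComplexity.GRWord Literature.Computability.QuantumComplexity.QFTQubits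
  Literature.Computability.QuantumComplexity.QFTWord Literature.Computability.QuantumComplexity.TidyBlockFn
  Literature.Computability.QuantumComplexity.QState Literature.Computability.QuantumComplexity.GRMassTable
  Literature.Computability.QuantumComplexity.GRTableMach
  Literature.Computability.Complexity Literature.LinearAlgebra.Matrix.Berkowitz Peikert2009 Finset _root_.Matrix SamplerArith
  SamplerScale SamplerGeom SamplerWords SamplerWordFns SamplerFormats SamplerQuery CVPOracle SamplerClassical
  SamplerClassical.Layout SamplerSubst SamplerDecode _root_.Computability Module
open Literature.Computability.QuantumComplexity.GRCosineMach (pcode abs_cosA_le_one cosA_update)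
open scoped Real

/-! ### The kernel of the inner family -/

/-- With no ancillas the padded input is the input, wire by wire. [cite: NielsenChuang2010, §4.5] -/
theorem padInput_zero_apply {N : ℕ} (x : QReg N) (i : Fin (N + 0)) : padInput x 0 i = x ⟨i, i.2⟩ := by
  have : ∃ j : Fin N, i = Fin.castAdd 0 j := ⟨⟨i, i.2⟩, Fin.ext rfl⟩
  obtain ⟨j, rfl⟩ := this
  rw [padInput, Fin.append_left]
  rfl

/-- A word read back from its register content. [cite: NielsenChuang2010, §4.5] -/
theorem getD_eq_get (u : List Bool) (w : Fin u.length) : u.getD w false = u.get w := by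
  rw [List.getD_eq_getElem _ _ w.2, List.get_eq_getElem]

/-- **The kernel of the inner family on a word `u`**: the Born law of its circuit at `|u|` run on `|u⟩`, mapped to
lists. [cite: NielsenChuang2010, §2.2.5, §4.5] -/
theorem kernel_innerFamily (Rf : UniformQCircuitFamily) (u : List Bool) :
    (innerFamily Rf).kernel 0 u =
      (bornPMF (((innerFamily Rf).circ u.length).runOn 0 (basisState fun w : Fin u.length => u.getD w false))).map
        List.ofFn := by
  have h : (fun w : Fin u.length => u.getD w false) = padInput u.get 0 := by
    funext i
    rw [padInput_zero_apply]
    exact getD_eq_get u _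
  rw [h]
  rfl

/-- **On a word of guarded length the inner family runs the guarded machine circuit of the decoded record.**
[cite: Regev2009, Lemma 3.14 (proof)] [cite: NielsenChuang2010, §4.5] -/
theorem kernel_innerFamily_of_guard (Rf : UniformQCircuitFamily) {N : ℕ} {s : Sz} (hs : szOf N = s)
    (hG : Guard Rf s N) (u : List Bool) (hu : u.length = N) :
    (innerFamily Rf).kernel 0 u =
      (bornPMF ((guardedCirc Rf s N hG).runOn 0 (basisState fun w : Fin N => u.getD w false))).map List.ofFn := by
  subst hu hs
  rw [kernel_innerFamily, circ_innerFamily_of_guard Rf hG]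
  try rfl

/-! ### Reading the residue register off the output list -/

/-- **The residue vector read off an output LIST**: block `i` is the `ℓ_R` bits at `o_S + i ℓ_R`.
[cite: Regev2009, Lemma 3.14 (proof: "measure … obtain t")] -/
def listReadS (n ℓR oS : ℕ) (y : List Bool) : Fin n → ZMod (2 ^ ℓR) :=
  fun i => bitsEquiv ℓR fun j => y.getD (oS + ((i : ℕ) * ℓR + j)) false

variable {W : ℕ} (I : LatticeInstance) {Λ : Layout W I.n} (hΛ : Λ.OK)

include hΛ in
/-- For a layout placed in order, reading the list of a register content is reading the residue blocks.
[cite: Regev2009, Lemma 3.14 (proof: "measure … obtain t")] -/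
theorem listReadS_ofFn (hloc : ∀ i, Λ.loc i = i) (z : QReg W) :
    listReadS I.n Λ.ℓR Λ.oS (List.ofFn z) = readS (Sblk I hΛ) z := by
  funext i
  unfold listReadS readS
  congr 1
  funext j
  have hlt : Λ.oS + ((i : ℕ) * Λ.ℓR + j) < Λ.T := by
    have hj := blk_lt i j
    have hT := Λ.T_eq
    obtain ⟨-, -, hS', -, -⟩ := offs_eq I Λ
    omega
  have hv : (Sblk I hΛ i j : ℕ) = Λ.oS + ((i : ℕ) * Λ.ℓR + j) := by rw [sblk_apply, Layout.fin_val hΛ hlt, hloc]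
  rw [← hv, List.getD_eq_getElem _ _ (by rw [List.length_ofFn]; exact (Sblk I hΛ i j).2), List.getElem_ofFn]

/-- **The decoded residue vector read off an output list.** [cite: Regev2009, Lemma 3.14 (proof, last step)] -/
def listDecS (ℓR oS : ℕ) (y : List Bool) : Fin I.n → ℤ :=
  decZ I (2 ^ ℓR) (listReadS I.n ℓR oS y)

/-! ### The per-block bound for the inner family -/

section Inner

variable [IsZLattice ℝ I.lattice] [NeZero I.n] (e T m L Lq np p₀ wpad : ℕ)

open Classical in
/-- **Regev 2009, Lemma 3.14 — the per-block bound for the INNER FAMILY on the standard word.** For a nonsingular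
`B` (`n ≥ 5`), sizes `(e, T, m, L, Lq, np, p₀)` and a padding amount `wpad` whose length code `N` passes the guard
(`Guard Rf s N`: the thirteen well-formedness inequalities of the machine circuit on `N` wires), positive rationals
`aq, ρ` with `2^{-T} ≤ √2ρ√n/aq ≤ 2^T` and the promise `aq/(√2ρ) < λ₁(L(B)*)/2`, a query prefix `Fq` of length `Lq`
in the canonical format, and the parameter word of the clamped table in the padding at offset `p₀`: the law of the
residue vector read off the output of `innerFamily Rf` on the standard word and decoded by `decZ` is within
`8·√(weightedFail Rf B r k y (aq/(√2ρ)) w) + νlevel(n)` of `intCoords_* D_{L(B), ρ√n/aq}` — the inner family is the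
sampler. [cite: Regev2009, Lemma 3.14 (statement and proof), Lemma 3.12 (proof)] [cite: NielsenChuang2010, §2.2.5, §4.5]
[cite: BernsteinVazirani1997, §8] -/
theorem tvDist_innerFamily_kernel_le (Rf : UniformQCircuitFamily)
    (hG : Guard Rf ⟨I.n, e, T, m, L, Lq, np, p₀⟩ (lenCode ⟨I.n, e, T, m, L, Lq, np, p₀⟩ wpad))
    (hI : I.IsNonsingular) (he : I.encode.length ≤ e) (hne : I.n ≤ e) (he2 : 2 ≤ e)
    (hn5 : 5 ≤ I.n) (hm : schedL I.n e T 0 + 13 ≤ m)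
    (aq ρ : ℚ) (haq : 0 < aq) (hρ : 0 < ρ)
    (htT : tW (aq : ℝ) (ρ : ℝ) I.n ≤ (2 : ℝ) ^ T) (hTt : (2⁻¹ : ℝ) ^ T ≤ tW (aq : ℝ) (ρ : ℝ) I.n)
    (hprom : (aq : ℝ) / (Real.sqrt 2 * ρ) < minNorm (dualLattice I.lattice) / 2)
    (r : ℚ) (k : ℕ) (y : List Bool) (e' : ℚ) (Fq pad' : List Bool)
    (hFq0 : Fq = boolPair (boolPair (stageInput (GapSVPInstance.encode (I, r)) (k + 1) y)
      (boolPair (encodeNat (schedR I.n e T m)) (encodeNat (schedB I.n e T)))) [])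
    (hFq : Fq.length = Lq)
    (hnp : (pcode ((Spar (2 ^ schedR I.n e T m) (detA I) aq ρ I.n, (4 * (2 * m + schedL I.n e T m + 3),
      6 * (4 * (2 * m + schedL I.n e T m + 3) + schedL I.n e T m + 3))), (2 * m + 1, schedL I.n e T m))).length ≤ np)
    (g : ℕ) (hg : Fq.length + (boolPair (pallE ((parOf I, 2 ^ schedR I.n e T m), e')) []).length + g = p₀)
    (huz : (zoneOf Fq ((parOf I, 2 ^ schedR I.n e T m), e') (padWord g (mach LevelCode.clamp
      (Spar (2 ^ schedR I.n e T m) (detA I) aq ρ I.n) (4 * (2 * m + schedL I.n e T m + 3))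
      (6 * (4 * (2 * m + schedL I.n e T m + 3) + schedL I.n e T m + 3)) (2 * m + 1) (schedL I.n e T m) np hnp).c pad')).length = L)
    (x' : EuclideanSpace ℝ (Fin I.n)) :
    (((innerFamily Rf).kernel 0
        (stdWord I (schedLayout I.n e T m L Lq (lenCode ⟨I.n, e, T, m, L, Lq, np, p₀⟩ wpad) hG.1)
          (zoneOf Fq ((parOf I, 2 ^ schedR I.n e T m), e') (padWord g (mach LevelCode.clamp
            (Spar (2 ^ schedR I.n e T m) (detA I) aq ρ I.n) (4 * (2 * m + schedL I.n e T m + 3))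
            (6 * (4 * (2 * m + schedL I.n e T m + 3) + schedL I.n e T m + 3)) (2 * m + 1) (schedL I.n e T m) np hnp).c pad'))
          (List.ofFn (GRData.init (mach LevelCode.clamp
            (Spar (2 ^ schedR I.n e T m) (detA I) aq ρ I.n) (4 * (2 * m + schedL I.n e T m + 3))
            (6 * (4 * (2 * m + schedL I.n e T m + 3) + schedL I.n e T m + 3)) (2 * m + 1) (schedL I.n e T m) np hnp))))).map
        (listDecS I (schedR I.n e T m) (I.n * schedL I.n e T m + L + I.n * schedY I.n e))).tvDist
      ((discreteGaussian I.lattice ((ρ : ℝ) * Real.sqrt I.n / aq) 0).map I.intCoords) ≤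
      8 * Real.sqrt (weightedFail Rf I r k y ((aq : ℝ) / (Real.sqrt 2 * ρ))
              (dataLaw (boxSet I.n (schedL I.n e T m) (DT I (2 ^ schedR I.n e T m) (tW (aq : ℝ) (ρ : ℝ) I.n)))
                (fun x => (gaussianFunction 1 x / zBox (boxSet I.n (schedL I.n e T m) (DT I (2 ^ schedR I.n e T m) (tW (aq : ℝ) (ρ : ℝ) I.n)))) ^ 2)
                (fun _ _ => sq_nonneg _)
                (sum_boxWeight_eq_one (boxSet_nonempty I.n (schedL I.n e T m) (DT I (2 ^ schedR I.n e T m) (tW (aq : ℝ) (ρ : ℝ) I.n))))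
                (cOf I (schedLayout I.n e T m L Lq (lenCode ⟨I.n, e, T, m, L, Lq, np, p₀⟩ wpad) hG.1) (tW (aq : ℝ) (ρ : ℝ) I.n)))).toReal +
        νlevel I.n := by
  -- the guard, opened
  obtain ⟨hN, hLq, hX, hY, hS, hWY, hWS, hWX, hWF, hWZ, hnp₀, hp, hWE⟩ := hG
  set NN := lenCode ⟨I.n, e, T, m, L, Lq, np, p₀⟩ wpad
  set ΛS := schedLayout I.n e T m L Lq NN hN
  have hOK : ΛS.OK := schedLayout_OK (n := I.n) (e := e) (T := T) (m := m) (L := L) (Lq := Lq) (W := NN) hN hLq hX hY hS hWF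
  have hWE' : ΛS.base + I.n * GRData.B (schedL I.n e T m) np (wlen LevelCode.clamp (schedL I.n e T m) np) (2 * m + 1 + 1) ≤ NN :=
    hWE
  set mc := mach LevelCode.clamp (Spar (2 ^ schedR I.n e T m) (detA I) aq ρ I.n) (4 * (2 * m + schedL I.n e T m + 3))
      (6 * (4 * (2 * m + schedL I.n e T m + 3) + schedL I.n e T m + 3)) (2 * m + 1) (schedL I.n e T m) np hnp
  set uz := zoneOf Fq ((parOf I, 2 ^ schedR I.n e T m), e') (padWord g mc.c pad')
  set ws := GRData.ws (schedL I.n e T m) np (wlen LevelCode.clamp (schedL I.n e T m) np) (2 * m + 1 + 1)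
  have hws : ∀ j, (ws j : ℕ) = j := fun j => ws_val _ _ _ _ j
  have hloc : ∀ i, ΛS.loc i = i := fun _ => rfl
  have hbT : ΛS.base = ΛS.T :=
    (stdLayout_T I.n (schedL I.n e T m) (schedY I.n e) (schedR I.n e T m) (schedB I.n e T) L Lq NN hN).symm
  have hx₀ : ∀ q : Fin (GRData.B (schedL I.n e T m) np (wlen LevelCode.clamp (schedL I.n e T m) np) (2 * m + 1 + 1)),
      (q : ℕ) < ΛS.ℓ → GRData.init mc q = false := fun q hq => GRData.init_of_lt mc hq
  have huzL : uz.length = ΛS.L := huz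
  -- the word has the guarded length
  have hlen : (stdWord I ΛS uz (List.ofFn (GRData.init mc))).length = NN := by
    refine length_stdWord I hbT huzL ?_
    rw [List.length_ofFn]; exact hWE'
  -- the kernel is the Born law of the guarded circuit on the word's content
  rw [kernel_innerFamily_of_guard Rf (N := NN) (s := ⟨I.n, e, T, m, L, Lq, np, p₀⟩) (szOf_lenCode _ wpad)
    ⟨hN, hLq, hX, hY, hS, hWY, hWS, hWX, hWF, hWZ, hnp₀, hp, hWE⟩ _ hlen, PMF.map_comp]
  -- the word's content is the prepared label
  have hψ : basisState (fun w : Fin NN => (stdWord I ΛS uz (List.ofFn (GRData.init mc))).getD w false) =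
      basisState (boxLab (stdEmb I hOK hWE') ws (GRData.init mc)
        (lab₀ I ΛS (2 ^ schedR I.n e T m) (tW (aq : ℝ) (ρ : ℝ) I.n) uz x') (fun _ => GRData.init mc ∘ ws)) :=
    congrArg basisState (funext fun w => (boxLab_stdEmb_eq_getD I hOK hloc hbT ws hws hWE' (GRData.init mc) hx₀
      (2 ^ schedR I.n e T m) (tW (aq : ℝ) (ρ : ℝ) I.n) uz huzL x' w).symm)
  -- the list reader is the register reader
  have hR : listDecS I (schedR I.n e T m) (I.n * schedL I.n e T m + L + I.n * schedY I.n e) ∘ List.ofFn =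
      fun z => decZ I (2 ^ schedR I.n e T m) (readS (Sblk I hOK) z) := by
    funext z
    rw [Function.comp_apply, listDecS]
    have h := listReadS_ofFn I hOK hloc z
    have hoS : ΛS.oS = I.n * schedL I.n e T m + L + I.n * schedY I.n e := (offs_eq I ΛS).2.2.1
    rw [hoS] at h
    exact congrArg (decZ I (2 ^ schedR I.n e T m)) h
  rw [hψ, hR]
  exact tvDist_machineCircPar_le_canonical I e T m L Lq NN hN hI he hne he2 hn5 hm hLq hX hY hS hWY hWS hWX hWF aq ρ haq hρ
    htT hTt hprom r k y e' Fq pad' hFq0 hFq Rf hWZ _ np hnp 0 hnp₀ p₀ g hp hg huz hWE x' le_rfl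

end Inner

end SamplerRegs

end Regev2009

end Literature.Computability.Cryptography

end
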